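import Summits.CriticalPhenomena.PercolationContinuityZ3.Theorems.Transplant.FKConnectivityAllQPat3TwoLevelInduction
import Summits.CriticalPhenomena.PercolationContinuityZ3.Theorems.Transplant.FKConnectivityAllQPat3C1Plus
import HarnessLib

/-!
# Connectivity correlation inequalities for `φ_{w,q}`, every `q > 0` — THEOREM 𝒯₂⁺ (census g38): the thirteen-member family
# `famPlus` (𝒯₁ ∪ 𝒯₂ with `C1, C1~` replaced by `C1⁺`) is nonnegative on every two-terminal series–parallel network

Theorems file (`--supports stmt-CriticalPhenomena-4575`), census lane `prim-bschramm-census` (gen 38) of the post-continuity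
programme (LANE 2 bschramm, FK sub-lane); builds on p205010 (kernel theorem, internal audit signed; external expert review
pending).  No named facts, no sorries, nothing probabilistic.  `…Pat3C1Plus` proved (by `decide`) that `FK.famPlus` passes the
four closed-family checks; `…Pat3TwoLevelInduction`'s induction lemma `FK.fam_nonneg_of_isTTSP` turns that into nonnegativity of
every member, member `C1⁺` in particular, at (terminal, terminal, inner mark) on every `IsTTSP` network for all nonnegative
weights.  (For `C1⁺` alone this also follows from `FK.c1_nonneg` and `FK.c1Tab_le_c1plusTab`; the content is that the family
WITHOUT the terminal-only member `C1` is closed — memo FROM-census-g38-HUB-K4FREE §8.)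
[cite: AyyerLinussonRavichandran2025, §7 eq. (13)–(15) (p. 22)] [cite: Grimmett2006, §3.8 (pp. 61–62)]
-/

namespace Summit.CriticalPhenomena.PercolationContinuityZ3.Theorems

namespace FK

open SimpleGraph Literature.Probability.LatticeModels Literature.Probability.Percolation
open scoped Classical

variable {V : Type*} [Fintype V] {E : Finset (Sym2 V)} {x y s : V}

/-- **THEOREM 𝒯₂⁺ (census g38)**: every member of `famPlus` — `famT12` with `C1, C1~` replaced by `C1⁺` — is nonnegative, for
all nonnegative weights, on every two-terminal series–parallel network `E` between `x` and `y` with an inner third mark `s`.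
PROOF: `FK.fam_nonneg_of_isTTSP` with the four `decide`d checks `famPlus_cert_*`. [cite: AyyerLinussonRavichandran2025, §7 (p. 22)] -/
theorem famPlus_nonneg (hE : IsTTSP E x y) (hs : ∃ e ∈ E, s ∈ e) (hsx : s ≠ x) (hsy : s ≠ y) {w : ℕ → ℝ}
    (hw : ∀ n, 0 ≤ w n) (i : ℕ) : 0 ≤ mval2 w E x y s (famGet famPlus i) :=
  fam_nonneg_of_isTTSP famPlus_cert_par famPlus_cert_serL famPlus_cert_serR famPlus_cert_serS hE s hs hsx hsy w hw i

/-- **THEOREM 𝒯₂⁺, member `C1⁺`**: `0 ≤ mval2 w E x y s c1plusTab` on every TTSP network at (terminal, terminal, inner).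
[cite: AyyerLinussonRavichandran2025, §7 (p. 22)] -/
theorem c1plus_nonneg (hE : IsTTSP E x y) (hs : ∃ e ∈ E, s ∈ e) (hsx : s ≠ x) (hsy : s ≠ y) {w : ℕ → ℝ}
    (hw : ∀ n, 0 ≤ w n) : 0 ≤ mval2 w E x y s c1plusTab :=
  famPlus_nonneg hE hs hsx hsy hw 4

end FK

end Summit.CriticalPhenomena.PercolationContinuityZ3.Theorems
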